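import Mathlib
import HarnessLib
import Summits.ResolutionOfSingularities.ResolutionOfSingularities.Theorems.WildQuotientsWildQuotientResolutionS1aKillFamily

/-!
# S1a — EXTENSION OF A REES FILTRATION BY THE UNIT FILTRATION ((K2) proper: from a `G`-stable open to the whole model)

[OURS · L1 W4.5c · lead-1 g8; plan-1 STRATEGY-DESIGN v3.2 §1 (K2) «… extends by the unit filtration to a global G-stable `ReesFiltration M.V`;
`IsPrincipalCentre` then holds chartwise by construction»] — NOT statements of the manuscript; counted 0; AI-level work, weaker than expert review.
Crux stmt-ResolutionOfSingularities-17941, line `s1a-logminvertex` v6, stub `stub_winningStrategy`. Route-independent.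

* `pushforwardRees 𝒦 j` — the pieces `(𝒦ₙ).map j` (Mathlib `Scheme.IdealSheafData.map` = extension by the unit ideal along an open immersion);
  `comap_map_of_isOpenImmersion` (restricting back gives `𝒦`), `comap_aut_map` / `comap_aut_pushforwardRees` (`G`-STABILITY is inherited along an
  equivariant open immersion), `image_stable`;
* ★ `isPrincipalCentreChart_image` — a principal-centre chart `U₀` of `(V', ρ', 𝒦)` upstairs IS a principal-centre chart `j '' U₀` of
  `(V, ρ, pushforwardRees 𝒦 j)` downstairs (sections via `Scheme.Hom.appIso`, filtration via `ideal_map`);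
* ★★ `isPrincipalCentre_pushforwardRees` — a PRINCIPAL CENTRE for the restricted action on a `G`-stable open `U` whose support has CLOSED image in `V`
  extends (by the unit filtration) to a PRINCIPAL CENTRE on `V` (idle node charts off the closed support: node atlas + `exists_isNodeChart_le`);
  `mem_principalKillOpen_pushforwardRees` (its kill-open contains the images of the kill-opens upstairs).
So the K side needs local principal centres only on `G`-stable OPENS around the bad components, with closed supports ((K3)) — then `KillFamily` glues.
-/

set_option linter.dupNamespace false

noncomputable section

universe u

open CategoryTheory Limits AlgebraicGeometry TopologicalSpace Topology
open Literature.AlgebraicGeometry.Resolution Literature.AlgebraicGeometry.RelativeSpec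
open Summit.ResolutionOfSingularities.ResolutionOfSingularities.Theorems.WildQuotientResolution.S1
open Summit.ResolutionOfSingularities.ResolutionOfSingularities.Theorems.WildQuotientResolution.S1.NodeAtlas
open Summit.ResolutionOfSingularities.ResolutionOfSingularities.Theorems.WildQuotientResolution.S1.BlowupCharts
open Summit.ResolutionOfSingularities.ResolutionOfSingularities.Theorems.WildQuotientResolution.S1.GoodCharts
open Summit.ResolutionOfSingularities.ResolutionOfSingularities.Theorems.WildQuotientResolution.S1.NodeChartAway
open Summit.ResolutionOfSingularities.ResolutionOfSingularities.Theorems.WildQuotientResolution.S1.KillableTransport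
open Summit.ResolutionOfSingularities.ResolutionOfSingularities.Theorems.WildQuotientResolution.S1.KillFamily

namespace Summit.ResolutionOfSingularities.ResolutionOfSingularities.Theorems.WildQuotientResolution.S1.ExtendRees

/-! ## The pushforward (extension by the unit ideal) of a Rees filtration -/

section Pushforward

variable {X Y : Scheme.{u}}

/-- **`pushforwardRees 𝒦 j`**: the Rees filtration `n ↦ (𝒦ₙ).map j` on `Y` (for an open immersion `j`: the largest ideal sheaves restricting to the `𝒦ₙ`
on the image — the EXTENSION BY THE UNIT FILTRATION). [OURS · L1 W4.5c] -/
def pushforwardRees (𝒦 : ReesFiltration X) (j : X ⟶ Y) : ReesFiltration Y where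
  ideal n := (𝒦.ideal n).map j
  ideal_zero := by rw [𝒦.ideal_zero, Scheme.IdealSheafData.map_top]
  antitone m n h := Scheme.IdealSheafData.map_mono j (𝒦.antitone h)
  mul_le m n := by
    rw [Scheme.IdealSheafData.le_map_iff_comap_le, comap_mul]
    exact (mul_mono (Scheme.IdealSheafData.comap_map_le _ _) (Scheme.IdealSheafData.comap_map_le _ _)).trans (𝒦.mul_le m n)

/-- Unfolding. -/
@[simp] theorem pushforwardRees_ideal (𝒦 : ReesFiltration X) (j : X ⟶ Y) (n : ℕ) : (pushforwardRees 𝒦 j).ideal n = (𝒦.ideal n).map j := rfl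

/-- Transport of membership in the local ideals along an EQUALITY of affine opens. -/
theorem map_eqToHom_mem_ideal_iff (K : X.IdealSheafData) {U₁ U₂ : X.Opens} (E : U₁ = U₂) (h₁ : IsAffineOpen U₁) (h₂ : IsAffineOpen U₂)
    (s : Γ(X, U₂)) : X.presheaf.map (eqToHom E).op s ∈ K.ideal ⟨U₁, h₁⟩ ↔ s ∈ K.ideal ⟨U₂, h₂⟩ := by
  subst E
  rw [eqToHom_refl, op_id, X.presheaf.map_id]
  rfl

/-- **Restricting the extension back gives the filtration**: `((K).map j).comap j = K` for a quasi-compact open immersion `j`. -/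
theorem comap_map_of_isOpenImmersion (K : X.IdealSheafData) (j : X ⟶ Y) [IsOpenImmersion j] [QuasiCompact j] :
    (K.map j).comap j = K := by
  refine le_antisymm (Scheme.IdealSheafData.comap_map_le K j) ?_
  rw [Scheme.IdealSheafData.le_def]
  intro U s hs
  have H : IsAffineOpen (j ⁻¹ᵁ j ''ᵁ (U : X.Opens)) := by rw [j.preimage_image_eq]; exact U.2
  rw [Scheme.IdealSheafData.ideal_comap_of_isOpenImmersion, Ideal.mem_comap,
    Scheme.IdealSheafData.ideal_map K j ⟨j ''ᵁ (U : X.Opens), U.2.image_of_isOpenImmersion j⟩ H, Ideal.mem_comap]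
  have h2 : (j.app (j ''ᵁ (U : X.Opens))).hom ((j.appIso (U : X.Opens)).inv.hom s) =
      (X.presheaf.map (eqToHom (j.preimage_image_eq (U : X.Opens))).op).hom s := by
    rw [← Scheme.Hom.appIso_inv_app]
    rfl
  rw [h2]
  exact (map_eqToHom_mem_ideal_iff K (j.preimage_image_eq (U : X.Opens)) H U.2 s).mpr hs

/-- The same for every piece of a Rees filtration. -/
theorem pullbackRees_pushforwardRees (𝒦 : ReesFiltration X) (j : X ⟶ Y) [IsOpenImmersion j] [QuasiCompact j] (n : ℕ) :
    (pullbackRees (pushforwardRees 𝒦 j) j).ideal n = 𝒦.ideal n := by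
  rw [pullbackRees_ideal, pushforwardRees_ideal, comap_map_of_isOpenImmersion]

/-- **Support of the extension** = closure of the image of the support. -/
theorem support_pushforwardRees (𝒦 : ReesFiltration X) (j : X ⟶ Y) [QuasiCompact j] (n : ℕ) :
    (((pushforwardRees 𝒦 j).ideal n).support : Set Y) = closure (j.base '' ((𝒦.ideal n).support : Set X)) := by
  rw [pushforwardRees_ideal, Scheme.IdealSheafData.support_map]
  rfl

end Pushforward

/-! ## `G`-stability is inherited -/

section Equivariant

variable {V' V Y : Scheme.{u}} {q : V ⟶ Y} {r' : V' ⟶ Y} {G : Type u} [Group G] (ρ : ActionOver q G) (ρ' : ActionOver r' G)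
  (j : V' ⟶ V) (hcomm : ∀ g : G, (ρ'.aut g).hom ≫ j = j ≫ (ρ.aut g).hom)

/-- `(ρ.aut g).hom ≫ (ρ.aut g⁻¹).hom = 𝟙`. -/
theorem aut_hom_comp_aut_inv_hom (g : G) : (ρ.aut g).hom ≫ (ρ.aut g⁻¹).hom = 𝟙 V := by
  rw [← Iso.trans_hom, ← Aut.Aut_mul_def, ← map_mul, inv_mul_cancel, map_one]
  rfl

/-- `(ρ.aut g⁻¹) ((ρ.aut g) x) = x`. -/
theorem aut_inv_base_aut_base (g : G) (x : V) : (ρ.aut g⁻¹).hom.base ((ρ.aut g).hom.base x) = x := by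
  rw [← Scheme.Hom.comp_apply, aut_hom_comp_aut_inv_hom]
  rfl

include hcomm in
/-- **The image of a `G`-stable open under an equivariant open immersion is `G`-stable.** -/
theorem image_stable [IsOpenImmersion j] (U₀ : V'.Opens) (hU₀ : ∀ g : G, (ρ'.aut g).hom ⁻¹ᵁ U₀ = U₀) (g : G) :
    (ρ.aut g).hom ⁻¹ᵁ (j ''ᵁ U₀) = j ''ᵁ U₀ := by
  -- `⊇` for every `g`
  have hsup : ∀ g : G, ∀ x : V, x ∈ (j ''ᵁ U₀ : Set V) → (ρ.aut g).hom.base x ∈ (j ''ᵁ U₀ : Set V) := by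
    rintro g _ ⟨u, hu, rfl⟩
    refine ⟨(ρ'.aut g).hom.base u, ?_, ?_⟩
    · change (ρ'.aut g).hom.base u ∈ (U₀ : Set V')
      have : u ∈ ((ρ'.aut g).hom ⁻¹ᵁ U₀ : Set V') := by rw [hU₀ g]; exact hu
      exact this
    · change ((ρ'.aut g).hom ≫ j).base u = ((j ≫ (ρ.aut g).hom)).base u
      rw [hcomm g]
  ext x
  constructor
  · intro hx
    have h1 := hsup g⁻¹ _ hx
    rw [aut_inv_base_aut_base] at h1
    exact h1
  · exact hsup g x

include hcomm in
/-- **`G`-stability is inherited by the extension** of a `G`-stable ideal sheaf along an equivariant quasi-compact open immersion. -/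
theorem comap_aut_map [IsOpenImmersion j] [QuasiCompact j] (K : V'.IdealSheafData) (hK : ∀ g : G, K.comap (ρ'.aut g).hom = K) (g : G) :
    (K.map j).comap (ρ.aut g).hom = K.map j := by
  have hle : ∀ g : G, (K.map j).comap (ρ.aut g).hom ≤ K.map j := fun g => by
    rw [Scheme.IdealSheafData.le_map_iff_comap_le, ← Scheme.IdealSheafData.comap_comp, ← hcomm g, Scheme.IdealSheafData.comap_comp,
      comap_map_of_isOpenImmersion, hK g]
  refine le_antisymm (hle g) ?_
  have h2 : ((K.map j).comap (ρ.aut g⁻¹).hom).comap (ρ.aut g).hom ≤ (K.map j).comap (ρ.aut g).hom :=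
    Scheme.IdealSheafData.comap_mono _ (hle g⁻¹)
  rwa [← Scheme.IdealSheafData.comap_comp, aut_hom_comp_aut_inv_hom, Scheme.IdealSheafData.comap_id] at h2

include hcomm in
/-- The extension of a `G`-stable Rees filtration is `G`-stable. -/
theorem comap_aut_pushforwardRees [IsOpenImmersion j] [QuasiCompact j] (𝒦 : ReesFiltration V')
    (h𝒦 : ∀ (g : G) (n : ℕ), (𝒦.ideal n).comap (ρ'.aut g).hom = 𝒦.ideal n) (g : G) (n : ℕ) :
    ((pushforwardRees 𝒦 j).ideal n).comap (ρ.aut g).hom = (pushforwardRees 𝒦 j).ideal n := by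
  rw [pushforwardRees_ideal]
  exact comap_aut_map ρ ρ' j hcomm (𝒦.ideal n) (fun g => h𝒦 g n) g

/-- The complement of the support of a `G`-stable ideal sheaf is `G`-stable. -/
theorem preimage_support_compl {I : V.IdealSheafData} (hI : ∀ g : G, I.comap (ρ.aut g).hom = I) (g : G) :
    (ρ.aut g).hom ⁻¹ᵁ I.support.compl = I.support.compl := by
  ext x
  change (ρ.aut g).hom.base x ∈ ((I.support : Set V))ᶜ ↔ x ∈ ((I.support : Set V))ᶜ
  rw [Set.mem_compl_iff, Set.mem_compl_iff, not_iff_not]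
  have h := congrArg (fun J : V.IdealSheafData => ((J.support : Set V))) (hI g)
  simp only [Scheme.IdealSheafData.support_comap, TopologicalSpace.Closeds.coe_preimage] at h
  exact Set.ext_iff.mp h x

end Equivariant

/-! ## A principal-centre chart upstairs is one downstairs -/

section Image

variable {V' V Y : Scheme.{u}} {q : V ⟶ Y} {r' : V' ⟶ Y} {G : Type u} [Group G] (ρ : ActionOver q G) (ρ' : ActionOver r' G)
  (j : V' ⟶ V) [IsOpenImmersion j] [QuasiCompact j] (hr' : r' = j ≫ q) (hcomm : ∀ g : G, (ρ'.aut g).hom ≫ j = j ≫ (ρ.aut g).hom)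
  {p : ℕ} (g₀ : G)

include hr' hcomm in
/-- ★ **A PRINCIPAL-CENTRE CHART `U₀` OF `(V', ρ', 𝒦)` IS A PRINCIPAL-CENTRE CHART `j '' U₀` OF `(V, ρ, pushforwardRees 𝒦 j)`** along an equivariant
quasi-compact open immersion `j` (same node and centre data; sections identified by `j.appIso U₀`). [OURS · L1 W4.5c] -/
theorem isPrincipalCentreChart_image (𝒦 : ReesFiltration V') (d : ℕ) (U₀ : ρ'.StableAffineOpens)
    (hkill : IsPrincipalCentreChart p ρ' g₀ 𝒦 d U₀) :
    ∃ O : ρ.StableAffineOpens, O.1 = j ''ᵁ U₀.1 ∧ IsPrincipalCentreChart p ρ g₀ (pushforwardRees 𝒦 j) d O := by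
  obtain ⟨hO, m, r, B, _, 𝒜, _, σ, e, htame, hσ, c, f, δ, w, hc, hf, hw, hK1, hK1', hσJ, h𝒦, hver, hprin⟩ := hkill
  have hstab : ∀ g : G, (ρ.aut g).hom ⁻¹ᵁ (j ''ᵁ U₀.1) = j ''ᵁ U₀.1 := image_stable ρ ρ' j hcomm U₀.1 U₀.2.1
  have hO₁ : IsAffineOpen (j ''ᵁ U₀.1) := hO.image_of_isOpenImmersion j
  haveI : IsAffineHom ((j ''ᵁ U₀.1).ι ≫ q) := by
    rw [← Scheme.Hom.isoImage_inv_ι j U₀.1, Category.assoc, Category.assoc, ← hr']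
    haveI := U₀.2.2
    infer_instance
  let O : ρ.StableAffineOpens := ⟨j ''ᵁ U₀.1, hstab, inferInstance⟩
  obtain ⟨P, hP⟩ : ∃ P : Γ(V, j ''ᵁ U₀.1) ≃+* Γ(V', U₀.1), ∀ s, P s = (j.appIso U₀.1).hom s :=
    ⟨(j.appIso U₀.1).commRingCatIsoToRingEquiv, fun _ => rfl⟩
  have hPle : ∀ s, P s = j.appLE (j ''ᵁ U₀.1) U₀.1 (j.preimage_image_eq U₀.1).ge s := fun s => by
    rw [hP, Scheme.Hom.appIso_hom']
  refine ⟨O, rfl, hO₁, m, r, B, inferInstance, 𝒜, inferInstance, σ, P.trans e, htame, fun t => ?_, c, f, δ, w, hc, hf, hw, hK1, hK1', hσJ,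
    fun n => ?_, hver, hprin⟩
  · have h1 : P ((ρ.aut g₀⁻¹).hom.appLE (j ''ᵁ U₀.1) (j ''ᵁ U₀.1) (hstab g₀⁻¹).ge t) =
        (ρ'.aut g₀⁻¹).hom.appLE U₀.1 U₀.1 (U₀.2.1 g₀⁻¹).ge (P t) := by
      rw [hPle, hPle]
      exact (appLE_comm_of_le ρ ρ' hcomm (j ''ᵁ U₀.1) hstab U₀.1 U₀.2.1 (j.preimage_image_eq U₀.1).ge g₀⁻¹ t).symm
    change (((P.trans e) ((ρ.aut g₀⁻¹).hom.appLE O.1 O.1 (O.2.1 g₀⁻¹).ge t) : ↥(𝒜 0)) : B) = σ (((P.trans e) t : ↥(𝒜 0)) : B)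
    rw [RingEquiv.trans_apply, RingEquiv.trans_apply, h1]
    exact hσ (P t)
  · have H : IsAffineOpen (j ⁻¹ᵁ j ''ᵁ U₀.1) := by rw [j.preimage_image_eq]; exact hO
    rw [ReesFiltration.filtration_ideal, pushforwardRees_ideal, Scheme.IdealSheafData.ideal_map _ j ⟨j ''ᵁ U₀.1, hO₁⟩ H]
    ext s
    rw [Ideal.mem_comap, Ideal.mem_comap]
    have h3 : ((P.trans e : Γ(V, j ''ᵁ U₀.1) ≃+* ↥(𝒜 0)) : Γ(V, j ''ᵁ U₀.1) →+* ↥(𝒜 0)) s ∈ (CoarseChart.traceFiltration 𝒜 f w).ideal n ↔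
        P s ∈ (𝒦.filtration ⟨U₀.1, hO⟩).ideal n := by
      rw [h𝒦 n, Ideal.mem_comap]
      rfl
    rw [h3, ReesFiltration.filtration_ideal, hP]
    have h4 : (j.appIso U₀.1).hom s = (V'.presheaf.map (eqToHom (j.preimage_image_eq U₀.1).symm).op) ((j.app (j ''ᵁ U₀.1)) s) := by
      rw [Scheme.Hom.appIso_hom]
      rfl
    rw [h4]
    exact (map_eqToHom_mem_ideal_iff (𝒦.ideal n) (j.preimage_image_eq U₀.1).symm hO H _).symm

end Image

/-! ## The extension theorem -/

section Extend

variable {V Y : Scheme.{u}} {q : V ⟶ Y} {G : Type u} [Group G] (ρ : ActionOver q G) {p : ℕ} (g₀ : G)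

/-- ★★ **EXTENSION BY THE UNIT FILTRATION.** Let `U ⊆ V` be a `G`-stable open of a locally Noetherian `V` carrying a node atlas, and `𝒦` a PRINCIPAL
CENTRE (degree `d`) for the restricted action on `↑U` whose support has CLOSED image in `V`. Then the extension `pushforwardRees 𝒦 U.ι` is a PRINCIPAL
CENTRE on `V`: principal-centre charts = the images of those of `𝒦`; idle node charts off the (closed) support. [OURS · L1 W4.5c] -/
theorem isPrincipalCentre_pushforwardRees [Finite G] [IsLocallyNoetherian V] (hnode : NodeAtlas p ρ g₀) (U : V.Opens)
    (hU : ∀ g : G, (ρ.aut g).hom ⁻¹ᵁ U = U) (𝒦 : ReesFiltration (U : Scheme.{u})) {d : ℕ}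
    (hprin : IsPrincipalCentre p (ρ.restrict U hU) g₀ 𝒦 d)
    (hC : IsClosed (U.ι.base '' (((𝒦.ideal d).support : Set (U : Scheme.{u}))))) :
    IsPrincipalCentre p ρ g₀ (pushforwardRees 𝒦 U.ι) d := by
  have hcomm : ∀ g : G, ((ρ.restrict U hU).aut g).hom ≫ U.ι = U.ι ≫ (ρ.aut g).hom := fun g => by
    rw [ActionOver.restrict_aut_hom, ActionOver.restrictHom_ι]
  have hGst : ∀ (g : G) (n : ℕ), ((pushforwardRees 𝒦 U.ι).ideal n).comap (ρ.aut g).hom = (pushforwardRees 𝒦 U.ι).ideal n :=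
    comap_aut_pushforwardRees ρ (ρ.restrict U hU) U.ι hcomm 𝒦 hprin.2.1
  -- the support of the extension is the (closed) image of the support
  have hsupp : (((pushforwardRees 𝒦 U.ι).ideal d).support : Set V) = U.ι.base '' ((𝒦.ideal d).support : Set (U : Scheme.{u})) := by
    rw [support_pushforwardRees, hC.closure_eq]
  refine ⟨hprin.1, hGst, fun v => ?_⟩
  by_cases hv : v ∈ (((pushforwardRees 𝒦 U.ι).ideal d).support : Set V)
  · -- over the support: the image of a principal chart upstairs
    rw [hsupp] at hv
    obtain ⟨u, hus, rfl⟩ := hv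
    obtain ⟨O₀, huO₀, hO₀ | hO₀⟩ := hprin.2.2 u
    swap
    · exact absurd hus (Set.disjoint_left.mp
        (disjoint_support_of_ideal_eq_top hO₀.1.1 (by rw [← ReesFiltration.filtration_ideal]; exact hO₀.2 d)) huO₀)
    obtain ⟨O, hOeq, hO⟩ := isPrincipalCentreChart_image ρ (ρ.restrict U hU) U.ι rfl hcomm g₀ 𝒦 d O₀ hO₀
    refine ⟨O, ?_, Or.inl hO⟩
    rw [hOeq]
    exact ⟨u, huO₀, rfl⟩
  · -- off the support: an idle node chart
    obtain ⟨O, hvO, hn⟩ := hnode v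
    obtain ⟨O'', hvO'', -, hO''W, hn''⟩ := exists_isNodeChart_le hn hvO ((pushforwardRees 𝒦 U.ι).ideal d).support.compl
      (preimage_support_compl ρ (fun g => hGst g d)) hv
    refine ⟨O'', hvO'', Or.inr ⟨hn'', fun n => filtration_eq_top_of_disjoint _ hprin.1 ⟨O''.1, hn''.1⟩ ?_ n⟩⟩
    rw [Set.disjoint_left]
    intro x hx hx'
    exact hO''W hx hx'

variable {X' X₁ : Scheme.{0}} {q₀ : X' ⟶ X₁} {G₀ : Type} [Group G₀] {ρ₀ : G₀ →* Aut X'} {g₁ : G₀}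

/-- **The kill-open of the extension contains the images of the kill charts upstairs.** [OURS · L1 W4.5c] -/
theorem mem_principalKillOpen_pushforwardRees (M : GameFrame.GModel p q₀ G₀ ρ₀ g₁) (U : M.V.Opens)
    (hU : ∀ g : G₀, (M.act.aut g).hom ⁻¹ᵁ U = U) (𝒦 : ReesFiltration (U : Scheme.{0})) (d : ℕ)
    {O₀ : (M.act.restrict U hU).StableAffineOpens} (hO₀ : IsPrincipalCentreChart p (M.act.restrict U hU) g₁ 𝒦 d O₀) {u : (U : Scheme.{0})}
    (hu : u ∈ O₀.1) : U.ι.base u ∈ M.principalKillOpen (pushforwardRees 𝒦 U.ι) d := by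
  haveI : IsLocallyNoetherian M.V := M.isLocallyNoetherian
  have hcomm : ∀ g : G₀, ((M.act.restrict U hU).aut g).hom ≫ U.ι = U.ι ≫ (M.act.aut g).hom := fun g => by
    rw [ActionOver.restrict_aut_hom, ActionOver.restrictHom_ι]
  obtain ⟨O, hOeq, hO⟩ := isPrincipalCentreChart_image M.act (M.act.restrict U hU) U.ι rfl hcomm g₁ 𝒦 d O₀ hO₀
  refine Set.mem_iUnion.mpr ⟨O, Set.mem_iUnion.mpr ⟨hO, ?_⟩⟩
  rw [hOeq]
  exact ⟨u, hu, rfl⟩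

/-- ★★ **A LOCAL PRINCIPAL CENTRE WITH CLOSED SUPPORT GIVES A GLOBAL ONE** (model form): on a model `M`, a principal centre for the restricted action
on a `G`-stable open `U` whose support has closed image extends to a principal centre on `M.V` whose kill-open contains every point of `U` lying in
a kill chart upstairs. [OURS · L1 W4.5c] -/
theorem exists_isPrincipalCentre_of_local [Finite G₀] (M : GameFrame.GModel p q₀ G₀ ρ₀ g₁) (U : M.V.Opens)
    (hU : ∀ g : G₀, (M.act.aut g).hom ⁻¹ᵁ U = U) (𝒦 : ReesFiltration (U : Scheme.{0})) {d : ℕ}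
    (hprin : IsPrincipalCentre p (M.act.restrict U hU) g₁ 𝒦 d)
    (hC : IsClosed (U.ι.base '' (((𝒦.ideal d).support : Set (U : Scheme.{0}))))) :
    ∃ 𝒦' : ReesFiltration M.V, IsPrincipalCentre p M.act g₁ 𝒦' d ∧
      (((𝒦'.ideal d).support : Set M.V) = U.ι.base '' ((𝒦.ideal d).support : Set (U : Scheme.{0}))) ∧
      ∀ (O₀ : (M.act.restrict U hU).StableAffineOpens), IsPrincipalCentreChart p (M.act.restrict U hU) g₁ 𝒦 d O₀ →
        ∀ u ∈ O₀.1, U.ι.base u ∈ M.principalKillOpen 𝒦' d := by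
  haveI : IsLocallyNoetherian M.V := M.isLocallyNoetherian
  refine ⟨pushforwardRees 𝒦 U.ι, isPrincipalCentre_pushforwardRees M.act g₁ M.atlas U hU 𝒦 hprin hC, ?_, fun O₀ hO₀ u hu =>
    mem_principalKillOpen_pushforwardRees M U hU 𝒦 d hO₀ hu⟩
  rw [support_pushforwardRees, hC.closure_eq]

end Extend

end Summit.ResolutionOfSingularities.ResolutionOfSingularities.Theorems.WildQuotientResolution.S1.ExtendRees

end
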